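import Summits.QuantumFields.BalabanUV.T4Continuum.Support.ShellMeasurePlaquetteCubicLocated
import Summits.QuantumFields.BalabanUV.T4Continuum.Support.ShellMeasurePinnedProp4Weighted

/-!
# `T4Continuum.ShellMeasurePlaquetteCubicLocatedPinnedLevels` — row S77 file 3: THE PINNED (P4) BINDER AT THE LIVE
# LEVELS FOR OUR η-SCALED ACTION — S77 file 1's η-free located kernel + the owner's S75 f2 `prop4Hyp_pinned_weighted`
(cell `pub-balaban`, sub-cell `t4`, spine estimate NE7c (node U5b), crew lineage `b2b-balaban-t4-ne7c-formalise-leaf-02` gen 8;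
owner table `LEAVES-NE7c-P1.md` row S77 (GO l.17266, say-so l.17336, owner's S75 f2 LANDED p226874 l.17512 «EXACTLY the shape
leaf-02-g8 asked»); imports S77 file 1 `ShellMeasurePlaquetteCubicLocated` (p226772) and the owner's S75 f2
`ShellMeasurePinnedProp4Weighted` (p226874) ONLY; [folklore]; 0 sorry, 0 def, one `Fact` instance)

HONEST FRAMING.  Finite four-torus programme, rung (B)+1 only — NOT infinite volume, NOT a mass gap, NOT the Clay
problem, NOT summit progress; (B), `BetaPertHyp`, (B^μ) are not consumed.  NE7c (`T4IndicatorShell.ShellWeightBound`)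
is NOT PRINTED and NOT PROVED; «NE7c ⇐ the named binders» (WALL `t4/b2b-balaban-t4-ne7c-p1/WALL-NE7c-P1.md` §2).
ELEMENTARY bookkeeping ([folklore]); [Balaban1985Variational] (39)∕(97)∕(98) are LOCATORS for the shape only — the
paper is under adjudication; nothing printed is asserted or cited as a fact; no `def` is minted.
HONEST DEPENDENCY (cell): continuum YM on T⁴ ⇐ BetaPertH ∧ nine spine estimates (0/9 proved); BetaPertH ⇐ (D1) ∧ (D4)
∧ CAP+tail; G-an2-4 gates asym, D1 and NE2/3/4.

THE POINT.  S77 file 1 proved the LOCATED quadratic majorant of OUR η-scaled action's gradient in the `WMax` currency with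
an η-FREE kernel, `located_quad_ord₃_eta_levels_kernel`; the owner's S75 f2 `ShellMeasurePinnedProp4Weighted.prop4Hyp_pinned_weighted`
turns exactly that shape (+ flat differentiability on the unpinned ball + the pin geometry and row sums as displayed data)
into `B11Prop6Scheme.Prop4Hyp` between the PINNED weighted spaces.  THIS FILE fires it:
**`prop4Hyp_pinned_ord₃_eta_levels`** — under f5d-c's geometric hypotheses, the pin `(ρ, posIn, posOut, ϖ, δ′)` and
`∀ c, Σ_b k c b·e^{δ′ρ(posOut c, posIn b)} ≤ M` for the η-free kernel
`k c b = 72(d−1)‖τ‖Lc³·[b.1.1 ∈ nbhdSites c.1.1 c.1.2] + 8κLc⁴·#{p ∈ Pl : c ∈ bonds (bd p) ∧ b ∈ bonds (bd p)}`,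
`κ = ‖τ‖(248∕3·ε₀ + 40∕3·ε)`:
`Prop4Hyp (Y ↦ (toPiL ((wt c)³·pin′)).symm (locGrad (etaScale η (Σ_p ord₃ plaqFunSym_p)) (toPiL (wt·pin) Y))) M (ε∕2)`
from `WMax (wt·e^{δ′ϖ∘posIn}) wd Dv` to `WSup ((wt)³·e^{δ′ϖ∘posOut}) 1 (𝔸 →L[ℂ] ℂ)` — S70 f4's `hW` IN THE PINNED
CURRENCY AT THE LIVE LEVELS, inhabited by OUR action, `M` VOLUME-FREE and η-FREE whenever the displayed row sums are.
NOT HERE: the row-sum bound itself (geometry of `nbhdSites`∕plaquette incidence against the pin — [dict]∕S69 (A)), the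
identification with Bałaban's sectioned objects (node O); no estimate of Bałaban's at a live level is discharged.
-/

noncomputable section

open scoped BigOperators

namespace Summit.QuantumFields.BalabanUV.T4Continuum.ShellMeasurePlaquetteCubicLocatedPinnedLevels

open Literature.MathematicalPhysics.QuantumFieldTheory.Balaban1983to89
open B7Prop1Explicit (e U1 mem_U1)
open B8Ineq132 (covDerivFwd)
open B11Prop6Scheme (Prop4Hyp)
open ShellMeasureWilsonGradientTail (plaqWord bonds)
open ShellMeasurePlaquetteTwist (plaqFunSym analyticAt_plaqFunSym)
open ShellMeasurePlaquetteCubicLocal (analyticAt_ord₃)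
open ShellMeasureLocalGradientTailJet (ord₃)
open Summit.QuantumFields.BalabanUV.T4Continuum.ShellMeasureCommutatorVariation (plaqStar)
open Summit.QuantumFields.BalabanUV.T4Continuum.ShellMeasureCommutatorGradientLocal (baseSites nbhdSites)
open Summit.QuantumFields.BalabanUV.T4Continuum.ShellMeasureCommutatorLocGrad (ext)
open Summit.QuantumFields.BalabanUV.T4Continuum.ShellMeasureLocalGradientTail (locGrad)
open Summit.QuantumFields.BalabanUV.T4Continuum.ShellMeasureGradientTailLevels (differentiableOn_locGrad_of_analyticOnNhd)
open Summit.QuantumFields.BalabanUV.T4Continuum.ShellMeasureMultiGridNorms (WSup)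
open Summit.QuantumFields.BalabanUV.T4Continuum.ShellMeasureMultiGridNormsMax (WMax)
open Summit.QuantumFields.BalabanUV.T4Continuum.ShellMeasurePinnedNorm (pinW)
open Summit.QuantumFields.BalabanUV.T4Continuum.ShellMeasurePinnedProp4Weighted (prop4Hyp_pinned_weighted)
open Summit.QuantumFields.BalabanUV.T4Continuum.ShellMeasureWilsonRemainderLevels (etaScale analyticOnNhd_etaScale)
open Summit.QuantumFields.BalabanUV.T4Continuum.ShellMeasurePlaquetteCubicAssembly (restr_unit_bounded)
open Summit.QuantumFields.BalabanUV.T4Continuum.ShellMeasurePlaquetteCubicLocated (located_quad_ord₃_eta_levels_kernel)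

export B7Prop1Explicit (Site)

variable {d : ℕ} {𝔸 : Type*} [NormedRing 𝔸] [NormOneClass 𝔸] [NormedAlgebra ℂ 𝔸] [CompleteSpace 𝔸]
  (Λ : Finset (Site d × Fin d)) (Pl : Finset (Fin d × Fin d × Site d)) (τ : 𝔸 →L[ℂ] ℂ)
  {U₀ : Site d → Fin d → 𝔸ˣ} (h₀ : ∀ y κ, U₀ y κ ∈ U1 𝔸) (bd : Fin d × Fin d × Site d → (Fin 4 → ↥Λ × Bool))
  (wt : ↥Λ → ℝ) [hwt : Fact (∀ b, 0 < wt b)] {I : Type*} [Fintype I] (wd : I → ℝ) [hwd : Fact (∀ i, 0 < wd i)]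
  (Dv : (↥Λ → 𝔸) →L[ℂ] (I → 𝔸)) (Wf Wd : ↥Λ → ℝ) (W : Fin d × Fin d × Site d → ℝ)

/-- The output weight `(wt c)³` (the `|·|_{(−3)}` reading) is positive. [folklore] -/
instance instFactPowThreePos : Fact (∀ c : ↥Λ, 0 < wt c ^ 3) := ⟨fun c => pow_pos (hwt.out c) 3⟩

include h₀ in
/-- THE η-SCALED ACTION'S ORDER-≥3 PART IS ENTIRE, hence its bond-local gradient is differentiable everywhere (read
through f2c's `WMax.toPiL`). [folklore] -/
theorem differentiable_locGrad_etaScale_sum_ord₃ (η : ℝ) :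
    Differentiable ℂ fun Y : WMax wt wd Dv =>
      locGrad (etaScale η (fun A : ↥Λ → 𝔸 =>
        ∑ p ∈ Pl, ord₃ (plaqFunSym τ (fun b : ↥Λ => U₀ b.1.1 b.1.2) (bd p)) A)) (WMax.toPiL wt wd Dv Y) := by
  obtain ⟨hU, hU'⟩ := restr_unit_bounded Λ h₀
  have hR : ∀ A : ↥Λ → 𝔸, AnalyticAt ℂ
      (fun A : ↥Λ → 𝔸 => ∑ p ∈ Pl, ord₃ (plaqFunSym τ (fun b : ↥Λ => U₀ b.1.1 b.1.2) (bd p)) A) A := fun A =>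
    Finset.analyticOnNhd_fun_sum Pl (s := Set.univ)
      (fun p _ B _ => analyticAt_ord₃ (analyticAt_plaqFunSym hU hU' τ (bd p) B)) A (Set.mem_univ A)
  have hd : DifferentiableOn ℂ (locGrad (etaScale η (fun A : ↥Λ → 𝔸 =>
      ∑ p ∈ Pl, ord₃ (plaqFunSym τ (fun b : ↥Λ => U₀ b.1.1 b.1.2) (bd p)) A))) Set.univ :=
    differentiableOn_locGrad_of_analyticOnNhd (analyticOnNhd_etaScale hR η Set.univ)
  exact (differentiableOn_univ.1 hd).comp (WMax.toPiL wt wd Dv).differentiable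

include h₀ in
/-- **THE PINNED (P4) BINDER AT THE LIVE LEVELS FOR OUR η-SCALED ACTION (row S77's END, fired).**  Data and DISPLAYED
hypotheses: those of S77 file 1's `located_quad_ord₃_eta_levels_kernel` (= f5d-c's: weights `wt`, `wd`, `W`, floors
`Wf`∕`Wd`, scale jump `Lc`, ∇-datum domination near the bond, `Pl` ⊇ stars increasing with boundaries `bd p = ∂p` oriented
`(+,+,−,−)`, `U₀` ∈ `U1` with `‖U₀(∂p) − 1‖ ≤ ε₀(η∕W p)²`, τ tracial, `η > 0`, `0 < ε`, `4ε ≤ 1`) + the PIN (`ρ` on a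
position type `S`, `posIn`, `posOut`, `ϖ ≥ 0` one-sided Lipschitz, `δ′ ≥ 0`) + the ROW SUMS of the η-free kernel
`∀ c, Σ_b k c b·e^{δ′ρ(posOut c, posIn b)} ≤ M`.  Conclusion — the owner's S75 f2 `prop4Hyp_pinned_weighted` FIRED with
`v₀ c = (wt c)³`: `Prop4Hyp (W_pin) M (ε∕2)` for `W := locGrad (etaScale η (Σ_p ord₃ plaqFunSym_p))` read from
`WMax (wt·e^{δ′ϖ∘posIn}) wd Dv` to `WSup ((wt)³·e^{δ′ϖ∘posOut}) 1 (𝔸 →L[ℂ] ℂ)` — S70 f4's `hW` IN THE PINNED CURRENCY AT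
THE LIVE LEVELS, inhabited by OUR action ([Balaban1985Variational] (98) TYPE, located; nothing printed is asserted).
[folklore] -/
theorem prop4Hyp_pinned_ord₃_eta_levels {η : ℝ} (hη : 0 < η) (htr : ∀ P Q : 𝔸, τ (P * Q) = τ (Q * P))
    (hincr : ∀ p ∈ Pl, p.1 < p.2.1) (hst : ∀ b : ↥Λ, plaqStar b.1.1 b.1.2 ⊆ Pl)
    (hbd : ∀ p ∈ Pl, ((bd p 0).1 : Site d × Fin d) = (p.2.2, p.1) ∧ ((bd p 1).1 : Site d × Fin d) = (p.2.2 + e p.1, p.2.1)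
      ∧ ((bd p 2).1 : Site d × Fin d) = (p.2.2 + e p.2.1, p.1) ∧ ((bd p 3).1 : Site d × Fin d) = (p.2.2, p.2.1))
    (hor : ∀ p ∈ Pl, (bd p 0).2 = true ∧ (bd p 1).2 = true ∧ (bd p 2).2 = false ∧ (bd p 3).2 = false)
    {Lc : ℝ} (hLc : 1 ≤ Lc) (hWd0 : ∀ b, 0 < Wd b)
    (hWf : ∀ b b' : ↥Λ, b'.1.1 ∈ nbhdSites b.1.1 b.1.2 → Wf b ≤ wt b')
    (hcf : ∀ b, wt b ≤ Lc * Wf b) (hcd : ∀ b, wt b ≤ Lc * Wd b)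
    (hDv : ∀ (A : ↥Λ → 𝔸) (b : ↥Λ) (x : Site d) (κ' τ' : Fin d), x ∈ baseSites b.1.1 →
      Wd b ^ 2 * ‖covDerivFwd η U₀ κ' (fun z => ext Λ A z τ') x‖ ≤ ‖(WSup.toPiL wd 2).symm (Dv A)‖)
    {ε ε₀ : ℝ} (hε : 0 < ε) (hε₀ : 0 ≤ ε₀) (hε4 : 4 * ε ≤ 1) (hηW : ∀ p ∈ Pl, η ≤ W p)
    (hWw : ∀ p ∈ Pl, ∀ b ∈ bonds (bd p), W p ≤ wt b) (hwW : ∀ p ∈ Pl, ∀ b ∈ bonds (bd p), wt b ≤ Lc * W p)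
    (hreg : ∀ p ∈ Pl, ‖(plaqWord (fun b : ↥Λ => U₀ b.1.1 b.1.2) (bd p) (0 : ↥Λ → 𝔸) : 𝔸) - 1‖ ≤ ε₀ * (η / W p) ^ 2)
    {S : Type*} (ρ : S → S → ℝ) (posIn posOut : ↥Λ → S) (ϖ : S → ℝ) {δ' M : ℝ} (hδ' : 0 ≤ δ')
    (hϖ0 : ∀ x, 0 ≤ ϖ x) (hϖ : ∀ x y, ϖ x ≤ ϖ y + ρ x y) (hM0 : 0 ≤ M)
    (hM : ∀ c : ↥Λ, ∑ b : ↥Λ,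
      (72 * ((d : ℝ) - 1) * ‖τ‖ * Lc ^ 3 * (if b.1.1 ∈ nbhdSites c.1.1 c.1.2 then 1 else 0)
        + 8 * (‖τ‖ * (248 / 3 * ε₀ + 40 / 3 * ε)) * Lc ^ 4 *
          ((Pl.filter (fun p => c ∈ bonds (bd p) ∧ b ∈ bonds (bd p))).card : ℝ))
        * Real.exp (δ' * ρ (posOut c) (posIn b)) ≤ M) :
    Prop4Hyp (fun Y : WMax (fun b => wt b * pinW δ' (ϖ ∘ posIn) b) wd Dv =>
        ((WSup.toPiL (fun c => wt c ^ 3 * pinW δ' (ϖ ∘ posOut) c) 1).symm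
          (locGrad (etaScale η (fun A : ↥Λ → 𝔸 =>
              ∑ p ∈ Pl, ord₃ (plaqFunSym τ (fun b : ↥Λ => U₀ b.1.1 b.1.2) (bd p)) A))
            (WMax.toPiL (fun b => wt b * pinW δ' (ϖ ∘ posIn) b) wd Dv Y)) :
          WSup (fun c => wt c ^ 3 * pinW δ' (ϖ ∘ posOut) c) 1 (𝔸 →L[ℂ] ℂ))) M (ε / 2) := by
  refine prop4Hyp_pinned_weighted wt wd Dv (fun c => wt c ^ 3) _ _ ρ posIn posOut ϖ hδ' hϖ0 hϖ (fun c b => ?_)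
    (fun Y hY c => located_quad_ord₃_eta_levels_kernel Λ Pl τ h₀ bd wt wd Dv Wf Wd W hη htr hincr hst hbd hor hLc hWd0
      hWf hcf hcd hDv hε hε₀ hε4 hηW hWw hwW hreg Y hY c) hM0 hM
    ((differentiable_locGrad_etaScale_sum_ord₃ Λ Pl τ h₀ bd wt wd Dv η).differentiableOn)
  -- the kernel is nonnegative
  have hd : 0 ≤ (d : ℝ) - 1 := by
    have : 1 ≤ d := Nat.succ_le_of_lt (Fin.pos c.1.2)
    have : (1 : ℝ) ≤ d := by exact_mod_cast this
    linarith
  have hLc0 : 0 ≤ Lc := zero_le_one.trans hLc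
  have h1 : 0 ≤ (if b.1.1 ∈ nbhdSites c.1.1 c.1.2 then (1 : ℝ) else 0) := by split_ifs <;> norm_num
  positivity

end Summit.QuantumFields.BalabanUV.T4Continuum.ShellMeasurePlaquetteCubicLocatedPinnedLevels

end
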